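import Literature.AlgebraicGeometry.Milne1999.SpecialLefschetzGroupInvariantsRealMultiplicationBlocksPowers
import HarnessLib

/-!
# Milne 1999, Cor. 4.5 / Thm. 3.2 / Prop. 3.6 (a) with multiplicity, §2 "type II": the `S`-invariants of ALL
# POWERS of a complex abelian variety with QUATERNIONIC multiplication are Lefschetz classes

Family `hodge`, layer `Literature/AlgebraicGeometry/Milne1999`, namespace
`Literature.AlgebraicGeometry.Milne1999` (D-0022). THEOREMS ONLY (no definition, no named fact, no `sorry`;
D-0026, net debt 0). Written for the cell `pub-hodgecm2` (COR-CM), seat `lit-milne`, binder table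
`HOME/lit/milne.md` rows M2/M4 (the record `Milne1999_specialLefschetzGroup_invariants_le` of
`Milne1999/LefschetzGroup`: Cor. 4.5 with Thm. 4.4 and Thm. 3.2, whose CONCLUSION is proved here on a new
locus; its wording is untouched and it is NOT discharged). Sequel of
`Milne1999/SpecialLefschetzGroupInvariantsRealMultiplicationBlocksPowers` (type I of any rank: ONE symplectic
group per eigenspace of a self-adjoint `φ^*`). Here a second endomorphism `κ` LINKS the eigenspaces of the
self-adjoint diagonalisable `ψ^*` in pairs `V_σ ↔ V_{σ'}` (`κ^* V_σ = V_{σ'}`, `σ' ≠ σ`, `κ^*κ^*` a non-zero scalar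
on each `V_σ`, `κ^*` symmetric or antisymmetric for the polarization form) and `C(A) ⊗ ℂ` is the commutant of
`{ψ^*, κ^*}`: the quaternion algebra `D = L ⊕ Lκ` over its centre, `L ∋ ψ` a maximal commutative subalgebra on
which `κ` acts by the non-trivial automorphism — Milne's "simple abelian variety of type II" (§2 p. 649). Then
`S(A)(ℂ) = ∏_{{σ,σ'}} Sp(V_σ)` acting on `V_σ ⊕ V_{σ'} ≅ V_σ ⊗ ℂ²` DIAGONALLY (multiplicity `2`, and `2(N+1)`
on `A^{N+1}`), and the several-blocks criterion `Milne1999/SpecialLefschetzGroupInvariantsSpBlocksMultiplicity`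
(coloured tensor FFT for `Sp`, Goodman–Wallach Thm. 5.3.3 (2)) gives the conclusion of the record on every
power `A^{N+1}`. No new invariant theory.

## Source, verbatim

J. S. Milne, *Lefschetz classes on abelian varieties*, Duke Math. J. 96 (1999) 639–675
[`paper:doi-10-1215-s0012-7094-99-09620-5`, held; PDF page = printed page − 638]:

* §1 p. 643: "For any positive integer `r`, `V(A^r) = rV(A)`, and the diagonal action of `C(A)` on `rV(A)`
  identifies `C(A)` with `C(A^r)`"; p. 644: "`S(A)` is the largest algebraic subgroup of `Sp(e_D)` whose
  elements commute with the endomorphisms of `A`".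
* §2 p. 649 (p0011 L35–p0012 L37): "Simple abelian variety of type II. […] there exists a basis `1, α, β, αβ`
  for `E` with `α² = a ∈ F` […], `β² = b ∈ F` […], `αβ = −βα`. […] Let `L = F[α]`. Then `E = L · 1 ⊕ L · β`,
  and so we can write `φ(x, y) = φ₁(x, y) + φ₂(x, y)β` […] `φ₁` is a skew-Hermitian form `V × V → L ⊗_ℚ k`,
  and `φ₂` is a skew-symmetric form. Therefore, `S(A) = ∏ᵢ Res_{Fᵢ/k} U(φ_{1,i}) ∩ Res_{Lᵢ/k} Sp(φ_{2,i})`.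
  Similarly, `S(A)_{/k^{al}} = ∏_{σ : F → k^{al}} U(φ_{1,σ}) ∩ Sp(φ_{2,σ})` […] Let `σ₁, σ₂ : L → k^{al}` be the
  extensions of `σ` to `L`. Then `V_σ = V_{σ₁} ⊕ V_{σ₂}` […] and `γ ↦ γ|V_{σ₁}` identifies
  `U(φ_{1,σ}) ∩ Sp(φ_{2,σ})` with `Sp(φ_{2,σ₁})`. The representation of `Sp(φ_{2,σ₁})` on `V_{σ₁}` is its
  standard representation, and its representation on `V_{σ₂}` is the contragredient of the standard
  representation (which is isomorphic to the standard representation)."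
* p. 654 "The symplectic group" (Fulton–Harris F.13); Prop. 3.6 (a) (p. 655): "`(⋀^*(rH))^G = k[(⊗² rH)^G]`
  all `r ≥ 1` […] (a) `G = Sp(φ)`"; p. 656: "`(⋀^*(⊕ rH_σ))^{∏S_σ} = ⊗_σ (⋀^* rH_σ)^{S_σ}`. Hence it suffices
  to show that each of the `k`-algebras `(⋀^* rH_σ)^{S_σ}` is generated by tensors of degree 2";
  Props. 3.3–3.4, Remark 3.7; Cor. 4.5, Cor. 4.7 (p. 659), Prop. 4.8 (p. 660).

The presentation used here: Milne splits `V_σ` by the CM subalgebra `L = F[α]` (`α` antisymmetric for the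
Rosati involution, `V_{σ₁}`, `V_{σ₂}` in duality); we split by a SYMMETRIC generator `ψ` of a maximal
commutative subalgebra (for type II, `E ⊗ ℝ ≅ M₂(ℝ)^e` with the Rosati involution the transpose, such
symmetric `ψ ∉ F` exist), so that the two halves `V_σ`, `V_{σ'} = κ^*V_σ` are `Q_h`-orthogonal, each
symplectic, and `κ^*` is a similitude between them: "standard ⊕ standard" instead of
"standard ⊕ contragredient" — the same group `Sp(φ_{2,σ₁})`, the same (isomorphic) representation.

## What is proved (complex `A`, Betti cohomology, the tree's carriers)

* §1 `exists_eq_of_mem_eigenspace` and the adapted basis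
  **`exists_linkedBlockBasis`**: for a non-degenerate `B`, a diagonalisable `B`-self-adjoint `J` with
  equidimensional eigenspaces and a `K` with `B(Kx, y) = ε B(x, Ky)` (`ε = ±1`), `K V_μ ⊆ V_{π μ}`
  (`π μ ≠ μ`) and `K² = c_μ ≠ 0` on `V_μ` — an eigenbasis `b(ℓ, k)` with `B`-orthogonal blocks, a
  fixed-point-free involution `τ` of the blocks with `K b(ℓ, k) = c_k b(ℓ, τ k)` and EQUAL Gram matrices on
  the blocks `k` and `τ k` (the letters of `V_{σ'}` are `κ^* / √(ε c)` of the letters of `V_σ`).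
* §2 **`mem_divisorClassesSpan_powSucc_of_forall_exteriorPullback_eq_of_quaternion`** — the `S(ℂ)`-form for
  every power `A^{N+1}`: the several-blocks criterion on the letters `prⱼ^* b(ℓ, k)`, colour of the slot
  `(j, k)` = the pair `{k, τ k}` (coded `min k (τ k)`), `Ω_k` = Gram matrix of `λ ∘ Q_h` on `V_k`
  (`Ω_{τ k} = Ω_k`); for `g ∈ Sp(Ω_k)` the automorphism acting by `g` on `V_k` AND on `V_{τ k}` and trivially
  elsewhere preserves `Q_h`, commutes with `ψ^*` and with `κ^*`, so lies in `S(A)(ℂ)` (`hC`), and its diagonal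
  image (`diagPow`) acts on all slots of that colour by `g`; the crossed classes of two slots `(j, k)`,
  `(j', k')`, `k' ∈ {k, τ k}`, are `∑ (Ω_k⁻¹)_{ac} prⱼ^* b(a,k) ⌣ (pr_{j'} ≫ κ^{0/1})^* b(c,k)` up to a scalar,
  divisor classes by `SymplecticPowers.sum_smul_cross_mem_span_rational_oneOne` because
  `θ_k = ∑ (Ω_k⁻¹)_{ac} b(a,k) ⌣ b(c,k) ∈ B¹(A) ⊗ ℂ` (every `u ∈ S(A)(ℂ)` preserves `V_k` and `Q_h`; Prop. 3.3
  in the `S(ℂ)`-form `mem_hodgeClassSpan_of_forall_exteriorPullback_eq`).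
* **`exists_polarization_invariants_le_powSucc_of_quaternion`** (the package consumed by
  `SpecialLefschetzGroupInvariantsFiniteProducts`), **`specialLefschetzGroup_invariants_le_powSucc_of_quaternion`**
  — the CONCLUSION of the record for every power `A^{N+1}`; `…_of_isIsogenous_powSucc_of_quaternion`
  (Cor. 4.7); Cor. 4.5 as an equality of sets; Prop. 4.8 (c) ⇒ (a) on `A^{N+1}`.

NOT here: Milne's own splitting by the CM subfield `L = F[α]` (isotropic halves in duality — the shape of
`…GLPowers`); type III (`β† = −β` AND `α† = −α`: orthogonal groups, Prop. 3.6 (b), needs the tensor FFT for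
`O`); the derivation of the hypotheses from "`End⁰(A)` is a quaternion algebra over a totally real field with
a positive involution"; the record itself.

## References

* [Milne1999LefschetzClasses] J. S. Milne, Lefschetz classes on abelian varieties, Duke Math. J. 96 (1999)
  639–675: §1 pp. 643–644, §2 pp. 646–650 (type II, p. 649), p. 654, Props. 3.3–3.4, 3.6 (a), Remark 3.7,
  p. 656, Thm. 4.4, Cor. 4.5, Cor. 4.7 (p. 659), Prop. 4.8 (p. 660).
* [GoodmanWallachGTM255] R. Goodman, N. R. Wallach, GTM 255 (2009), §1.1.2, Thm. 5.3.3 (2), Thm. 5.3.5,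
  (5.34), §4.1.1.
* [LangeBirkenhake1992] H. Lange, Ch. Birkenhake, Complex Abelian Varieties (1992), §5.3 and §5.5
  (endomorphism algebras of type II, the Rosati involution as the transpose on `M₂(ℝ)`).
* [MumfordAV1970] D. Mumford, Abelian Varieties (1970), §21 (Albert's classification, type II).
-/

noncomputable section

open scoped BigOperators Matrix
open CategoryTheory
open Literature.AlgebraicTopology.SingularHomology
open Literature.AlgebraicGeometry.HodgeTheory
open Literature.AlgebraicGeometry.Motives
open Literature.AlgebraicGeometry.VanGeemen1994 (pullbackOne hodgeClassSpan)
open Literature.Barriers.HodgeConjecture (divisorClassesSpan divisorMonomials mem_divisorMonomials_zero)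
open Literature.Geometry.Kaehler (lefschetzPow)
open Literature.RepresentationTheory.GeneralLinear
open Literature.RepresentationTheory.ClassicalInvariants
open Literature.NumberTheory.DiophantineGeometry

namespace Literature.AlgebraicGeometry.Milne1999

/-! ### §1 Linear algebra: the eigenbasis adapted to the linking endomorphism `κ^*` -/

section LinkedBlocks

variable {V : Type*} [AddCommGroup V] [Module ℂ V]

/-- A non-zero vector lies in at most one eigenspace. [folklore] -/
private theorem eigenvalue_eq_of_mem_of_mem {J : Module.End ℂ V} {a a' : ℂ} {v : V}
    (ha : v ∈ J.eigenspace a) (ha' : v ∈ J.eigenspace a') (hv : v ≠ 0) : a = a' := by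
  rw [Module.End.mem_eigenspace_iff] at ha ha'
  have h : (a - a') • v = 0 := by rw [sub_smul, ← ha, ← ha', sub_self]
  exact sub_eq_zero.1 ((smul_eq_zero.1 h).resolve_right hv)

/-- Bilinear expansion `B(∑ αₐ xₐ, ∑ β_c y_c) = ∑∑ αₐ β_c B(xₐ, y_c)`. [folklore] -/
private theorem bilin_sum_smul_sum_smul' (B : LinearMap.BilinForm ℂ V) {n : ℕ} (α β : Fin n → ℂ)
    (x y : Fin n → V) :
    B (∑ a, α a • x a) (∑ c, β c • y c) = ∑ a, ∑ c, α a * β c * B (x a) (y c) := by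
  simp only [map_sum, map_smul, LinearMap.sum_apply, LinearMap.smul_apply, smul_eq_mul, Finset.mul_sum]
  rw [Finset.sum_comm]
  refine Finset.sum_congr rfl fun a _ => Finset.sum_congr rfl fun c _ => ?_
  ring

variable {N₁ m : ℕ}

/-- **Every eigenvalue of a diagonalised operator is one of the diagonal entries**: if `b(ℓ, k)` is an
eigenbasis of `J` with eigenvalues `μ_k` and `v ≠ 0` is an eigenvector for `ν`, then `ν = μ_k` for some `k`
(a non-zero coordinate of `v` sees both eigenvalues). [cite: Milne1999LefschetzClasses, §2 p. 646 (`V = ⊕ V_σ`)] -/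
theorem exists_eq_of_mem_eigenspace (b : Module.Basis (Fin N₁ × Fin m) ℂ V) (J : Module.End ℂ V)
    {μ : Fin m → ℂ} (hJb : ∀ ℓ k, J (b (ℓ, k)) = μ k • b (ℓ, k)) {ν : ℂ} {v : V}
    (hv : v ∈ J.eigenspace ν) (hv0 : v ≠ 0) : ∃ k, ν = μ k := by
  classical
  have hne : b.repr v ≠ 0 := fun h0 => hv0 (b.repr.map_eq_zero_iff.1 h0)
  obtain ⟨⟨ℓ, k⟩, hℓk⟩ := Finsupp.ne_iff.1 hne
  rw [Finsupp.zero_apply] at hℓk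
  refine ⟨k, ?_⟩
  rw [Module.End.mem_eigenspace_iff] at hv
  have hexp : J v = ∑ i, (μ i.2 * b.repr v i) • b i := by
    conv_lhs => rw [← b.sum_repr v, map_sum]
    refine Finset.sum_congr rfl fun i _ => ?_
    obtain ⟨ℓ₀, k₀⟩ := i
    rw [map_smul, hJb, smul_smul, mul_comm]
  have h1 : b.repr (J v) (ℓ, k) = μ k * b.repr v (ℓ, k) := by
    rw [hexp, b.repr_sum_self]
  have h2 : b.repr (J v) (ℓ, k) = ν * b.repr v (ℓ, k) := by
    rw [hv, map_smul, Finsupp.smul_apply, smul_eq_mul]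
  have h3 : (ν - μ k) * b.repr v (ℓ, k) = 0 := by rw [sub_mul, ← h1, ← h2, sub_self]
  rcases mul_eq_zero.1 h3 with h | h
  · exact sub_eq_zero.1 h
  · exact absurd h hℓk

/-- **A family with invertible Gram matrix is linearly independent** (pair a vanishing combination with every
member). [folklore] -/
private theorem linearIndependent_of_det_gram_ne_zero {ι : Type*} [Fintype ι] [DecidableEq ι]
    (B : LinearMap.BilinForm ℂ V) (e : ι → V) (h : (Matrix.of fun i j => B (e i) (e j)).det ≠ 0) :
    LinearIndependent ℂ e := by
  rw [Fintype.linearIndependent_iff]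
  intro g hg i
  have hvec : Matrix.vecMul g (Matrix.of fun i j => B (e i) (e j)) = 0 := by
    funext j
    have e0 := congrArg (fun v => B v (e j)) hg
    simp only [map_sum, map_smul, LinearMap.sum_apply, LinearMap.smul_apply, smul_eq_mul, map_zero,
      LinearMap.zero_apply] at e0
    rw [Matrix.vecMul, dotProduct, Pi.zero_apply]
    simpa only [Matrix.of_apply] using e0
  exact congr_fun (Matrix.eq_zero_of_vecMul_eq_zero h hvec) i

variable [FiniteDimensional ℂ V]

/-- **The eigenbasis adapted to a linking endomorphism** (Milne's "`V_σ = V_{σ₁} ⊕ V_{σ₂}` […] the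
representation of `Sp(φ_{2,σ₁})` on `V_{σ₁}` is its standard representation, and its representation on
`V_{σ₂}` is […] isomorphic to the standard representation", p. 650, in the symmetric presentation). Let `B` be
non-degenerate, `J` diagonalisable and `B`-self-adjoint with all eigenspaces of dimension `N₁`, and `K` with
`B(Kx, y) = ε B(x, Ky)` (`ε = ±1`), `K V_μ ⊆ V_{π(μ)}` with `π(μ) ≠ μ` for eigenvalues `μ`, and `K ∘ K` a
non-zero scalar on every `V_μ`. Then there are distinct eigenvalues `μ_k` (`k ∈ Fin m`), a fixed-point-free
involution `τ` of `Fin m`, non-zero scalars `c_k` and a basis `b(ℓ, k)` (`ℓ ∈ Fin N₁`) with: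
`J b(ℓ,k) = μ_k b(ℓ,k)`; `B(b(ℓ,k), b(ℓ',k')) = 0` for `k ≠ k'`; `K b(ℓ,k) = c_k b(ℓ, τ k)`; and
`B(b(ℓ,τk), b(ℓ',τk)) = B(b(ℓ,k), b(ℓ',k))` (equal Gram matrices on linked blocks: the letters of `V_{τ k}`
are `K b(ℓ,k)/s` with `s² = ε c`). [cite: Milne1999LefschetzClasses, §2 pp. 649–650 (type II, `V_σ = V_{σ₁} ⊕ V_{σ₂}`)]
[cite: LangeBirkenhake1992, §5.5] -/
theorem exists_linkedBlockBasis (B : LinearMap.BilinForm ℂ V) (hBnd : B.Nondegenerate)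
    (J K : Module.End ℂ V) (hJ : ⨆ μ, J.eigenspace μ = ⊤) (hJB : ∀ x y, B (J x) y = B x (J y))
    (hV : 0 < Module.finrank ℂ V)
    (hn : ∀ μ, J.HasEigenvalue μ → Module.finrank ℂ (J.eigenspace μ) = N₁)
    {ε : ℂ} (hε : ε = 1 ∨ ε = -1) (hKB : ∀ x y, B (K x) y = ε * B x (K y))
    (π : ℂ → ℂ) (hπ : ∀ μ, J.HasEigenvalue μ → π μ ≠ μ)
    (hlink : ∀ μ v, v ∈ J.eigenspace μ → K v ∈ J.eigenspace (π μ))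
    (hK2 : ∀ μ, ∃ c : ℂ, c ≠ 0 ∧ ∀ v ∈ J.eigenspace μ, K (K v) = c • v) :
    ∃ (m : ℕ) (μ : Fin m → ℂ) (τ : Fin m → Fin m) (b : Module.Basis (Fin N₁ × Fin m) ℂ V) (c : Fin m → ℂ),
      Function.Injective μ ∧ (∀ k, τ (τ k) = k) ∧ (∀ k, τ k ≠ k) ∧
      (∀ ℓ k, J (b (ℓ, k)) = μ k • b (ℓ, k)) ∧
      (∀ ℓ ℓ' k k', k ≠ k' → B (b (ℓ, k)) (b (ℓ', k')) = 0) ∧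
      (∀ k, c k ≠ 0) ∧ (∀ ℓ k, K (b (ℓ, k)) = c k • b (ℓ, τ k)) ∧
      (∀ ℓ ℓ' k, B (b (ℓ, τ k)) (b (ℓ', τ k)) = B (b (ℓ, k)) (b (ℓ', k))) := by
  classical
  obtain ⟨m, μ, b₀, hμ, hJb, hcr⟩ := exists_uniformBlockEigenbasis B J hJ hJB N₁ hn
  -- the blocks are non-empty
  have hN₁ : 0 < N₁ := by
    have h := Module.finrank_eq_card_basis b₀
    rw [Fintype.card_prod, Fintype.card_fin, Fintype.card_fin] at h
    refine Nat.pos_of_ne_zero fun h0 => ?_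
    rw [h, h0, zero_mul] at hV
    exact lt_irrefl 0 hV
  have hm : 0 < m := by
    have h := Module.finrank_eq_card_basis b₀
    rw [Fintype.card_prod, Fintype.card_fin, Fintype.card_fin] at h
    refine Nat.pos_of_ne_zero fun h0 => ?_
    rw [h, h0, mul_zero] at hV
    exact lt_irrefl 0 hV
  haveI : Nonempty (Fin N₁ × Fin m) := ⟨(⟨0, hN₁⟩, ⟨0, hm⟩)⟩
  set ℓ₀ : Fin N₁ := ⟨0, hN₁⟩ with hℓ₀
  have hb0 : ∀ ℓ k, b₀ (ℓ, k) ≠ 0 := fun ℓ k => b₀.ne_zero _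
  have hmem₀ : ∀ ℓ k, b₀ (ℓ, k) ∈ J.eigenspace (μ k) := fun ℓ k =>
    Module.End.mem_eigenspace_iff.2 (hJb ℓ k)
  have hev : ∀ k, J.HasEigenvalue (μ k) := fun k =>
    Module.End.hasEigenvalue_of_hasEigenvector ⟨hmem₀ ℓ₀ k, hb0 _ _⟩
  -- the scalars `K² = bK k` on the blocks
  choose bK hbK0 hbK using fun k => hK2 (μ k)
  have hKne : ∀ {k : Fin m} {v : V}, v ∈ J.eigenspace (μ k) → v ≠ 0 → K v ≠ 0 := by
    intro k v hv hv0 hKv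
    have e := hbK k v hv
    rw [hKv, map_zero] at e
    exact hv0 ((smul_eq_zero.1 e.symm).resolve_left (hbK0 k))
  -- the involution `τ` of the blocks
  have hτex : ∀ k, ∃ k', π (μ k) = μ k' := fun k =>
    exists_eq_of_mem_eigenspace b₀ J hJb (hlink _ _ (hmem₀ ℓ₀ k)) (hKne (hmem₀ _ _) (hb0 _ _))
  choose τ hτ using hτex
  have hππ : ∀ k, π (π (μ k)) = μ k := by
    intro k
    have h1 : K (K (b₀ (ℓ₀, k))) ∈ J.eigenspace (π (π (μ k))) := hlink _ _ (hlink _ _ (hmem₀ _ k))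
    have h2 : K (K (b₀ (ℓ₀, k))) ∈ J.eigenspace (μ k) := by
      rw [hbK k _ (hmem₀ _ k)]
      exact Submodule.smul_mem _ _ (hmem₀ _ k)
    have h3 : K (K (b₀ (ℓ₀, k))) ≠ 0 := by
      rw [hbK k _ (hmem₀ _ k)]
      exact smul_ne_zero (hbK0 k) (hb0 _ _)
    exact eigenvalue_eq_of_mem_of_mem h1 h2 h3
  have hττ : ∀ k, τ (τ k) = k := fun k => hμ (by rw [← hτ (τ k), ← hτ k, hππ])
  have hτne : ∀ k, τ k ≠ k := fun k h => hπ (μ k) (hev k) (by rw [hτ, h])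
  have hlt_or : ∀ k, k < τ k ∨ τ k < k := fun k => lt_or_gt_of_ne (hτne k).symm
  -- `bK` is constant on linked pairs
  have hbKτ : ∀ k, bK (τ k) = bK k := by
    intro k
    have hKv : K (b₀ (ℓ₀, k)) ∈ J.eigenspace (μ (τ k)) := by
      rw [← hτ]
      exact hlink _ _ (hmem₀ _ k)
    have h1 : K (K (K (b₀ (ℓ₀, k)))) = bK (τ k) • K (b₀ (ℓ₀, k)) := hbK (τ k) _ hKv
    have h2 : K (K (K (b₀ (ℓ₀, k)))) = bK k • K (b₀ (ℓ₀, k)) := by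
      rw [hbK k _ (hmem₀ _ k), map_smul]
    have h3 : (bK (τ k) - bK k) • K (b₀ (ℓ₀, k)) = 0 := by rw [sub_smul, ← h1, ← h2, sub_self]
    exact sub_eq_zero.1 ((smul_eq_zero.1 h3).resolve_right (hKne (hmem₀ _ k) (hb0 _ _)))
  -- square roots `s k² = ε bK k`
  have hε0 : ε ≠ 0 := by rcases hε with rfl | rfl <;> norm_num
  have hεε : ε * ε = 1 := by rcases hε with rfl | rfl <;> norm_num
  have hsq : ∀ k, ∃ s : ℂ, ε * bK k = s * s := fun k => IsAlgClosed.exists_eq_mul_self _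
  choose s hs using hsq
  have hs0 : ∀ k, s k ≠ 0 := fun k h0 => by
    have e := hs k
    rw [h0, mul_zero] at e
    exact mul_ne_zero hε0 (hbK0 k) e
  -- the adapted family: `b₀` on the representative blocks `k < τ k`, transported letters on the others
  set e : Fin N₁ × Fin m → V := fun i =>
    if i.2 < τ i.2 then b₀ i else (s i.2)⁻¹ • K (b₀ (i.1, τ i.2)) with he_def
  have he_if : ∀ ℓ k, k < τ k → e (ℓ, k) = b₀ (ℓ, k) := fun ℓ k h => by
    simp only [he_def, if_pos h]
  have he_else : ∀ ℓ k, ¬ k < τ k → e (ℓ, k) = (s k)⁻¹ • K (b₀ (ℓ, τ k)) := fun ℓ k h => by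
    simp only [he_def, if_neg h]
  have hmem : ∀ ℓ k, e (ℓ, k) ∈ J.eigenspace (μ k) := by
    intro ℓ k
    by_cases h : k < τ k
    · rw [he_if ℓ k h]
      exact hmem₀ ℓ k
    · rw [he_else ℓ k h]
      refine Submodule.smul_mem _ _ ?_
      have h' := hlink _ _ (hmem₀ ℓ (τ k))
      rwa [hτ, hττ] at h'
  have hJe : ∀ ℓ k, J (e (ℓ, k)) = μ k • e (ℓ, k) := fun ℓ k => Module.End.mem_eigenspace_iff.1 (hmem ℓ k)
  have hcr' : ∀ ℓ ℓ' k k', k ≠ k' → B (e (ℓ, k)) (e (ℓ', k')) = 0 := fun ℓ ℓ' k k' hkk' =>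
    apply_eq_zero_of_mem_eigenspace_of_ne B J hJB (hμ.ne hkk') (hmem ℓ k) (hmem ℓ' k')
  -- `K` on the letters
  set c : Fin m → ℂ := fun k => if k < τ k then s (τ k) else (s k)⁻¹ * bK (τ k) with hc_def
  have hc0 : ∀ k, c k ≠ 0 := by
    intro k
    by_cases h : k < τ k
    · simp only [hc_def, if_pos h]
      exact hs0 _
    · simp only [hc_def, if_neg h]
      exact mul_ne_zero (inv_ne_zero (hs0 k)) (hbK0 _)
  have hKe : ∀ ℓ k, K (e (ℓ, k)) = c k • e (ℓ, τ k) := by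
    intro ℓ k
    rcases hlt_or k with h | h
    · have h' : ¬ τ k < τ (τ k) := by
        rw [hττ]
        exact lt_asymm h
      simp only [hc_def, if_pos h]
      rw [he_if ℓ k h, he_else ℓ (τ k) h', hττ, smul_smul, mul_inv_cancel₀ (hs0 _), one_smul]
    · have h' : ¬ k < τ k := lt_asymm h
      have h'' : τ k < τ (τ k) := by
        rw [hττ]
        exact h
      simp only [hc_def, if_neg h']
      rw [he_else ℓ k h', he_if ℓ (τ k) h'', map_smul, hbK (τ k) _ (hmem₀ ℓ (τ k)), smul_smul]
  have hBKK : ∀ (x : V) {y : V} {k : Fin m}, y ∈ J.eigenspace (μ k) →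
      B (K x) (K y) = ε * bK k * B x y := by
    intro x y k hy
    rw [hKB, hbK k y hy, map_smul, smul_eq_mul, mul_assoc]
  have hcsq : ∀ k, c k * c k = ε * bK k := by
    intro k
    rcases hlt_or k with h | h
    · simp only [hc_def, if_pos h]
      rw [← hs (τ k), hbKτ]
    · simp only [hc_def, if_neg (lt_asymm h)]
      have h1 : bK (τ k) = bK k := by
        have e := hbKτ (τ k)
        rw [hττ] at e
        exact e.symm
      rw [h1]
      have hs2 : s k * s k = ε * bK k := (hs k).symm
      have hεinv : ε⁻¹ = ε := by rcases hε with rfl | rfl <;> norm_num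
      have hbk := hbK0 k
      calc (s k)⁻¹ * bK k * ((s k)⁻¹ * bK k) = bK k * bK k * (s k * s k)⁻¹ := by
            rw [mul_inv]
            ring
        _ = ε * bK k := by
            rw [hs2, mul_inv, hεinv]
            field_simp
  have hGramτ : ∀ ℓ ℓ' k, B (e (ℓ, τ k)) (e (ℓ', τ k)) = B (e (ℓ, k)) (e (ℓ', k)) := by
    intro ℓ ℓ' k
    have h1 : e (ℓ, τ k) = (c k)⁻¹ • K (e (ℓ, k)) := by
      rw [hKe, smul_smul, inv_mul_cancel₀ (hc0 k), one_smul]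
    have h2 : e (ℓ', τ k) = (c k)⁻¹ • K (e (ℓ', k)) := by
      rw [hKe, smul_smul, inv_mul_cancel₀ (hc0 k), one_smul]
    rw [h1, h2]
    simp only [map_smul, LinearMap.smul_apply, smul_eq_mul]
    rw [hBKK _ (hmem ℓ' k), ← hcsq k]
    have hck := hc0 k
    field_simp
  -- the Gram matrices of the blocks are invertible
  let Ω₀ : Fin m → Matrix (Fin N₁) (Fin N₁) ℂ := fun k => Matrix.of fun ℓ ℓ' => B (b₀ (ℓ, k)) (b₀ (ℓ', k))
  have hGram₀ : LinearMap.BilinForm.toMatrix b₀ B = Matrix.blockDiagonal Ω₀ := by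
    ext ⟨ℓ, k⟩ ⟨ℓ', k'⟩
    rw [LinearMap.BilinForm.toMatrix_apply, Matrix.blockDiagonal_apply']
    split_ifs with hkk'
    · subst hkk'
      rfl
    · exact hcr ℓ ℓ' k k' hkk'
  have hdet₀ : ∀ k, (Ω₀ k).det ≠ 0 := by
    have hdet : (LinearMap.BilinForm.toMatrix b₀ B).det ≠ 0 :=
      (LinearMap.BilinForm.nondegenerate_iff_det_ne_zero b₀).1 hBnd
    rw [hGram₀, Matrix.det_blockDiagonal] at hdet
    exact fun k => (Finset.prod_ne_zero_iff.1 hdet) k (Finset.mem_univ k)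
  let Ω : Fin m → Matrix (Fin N₁) (Fin N₁) ℂ := fun k => Matrix.of fun ℓ ℓ' => B (e (ℓ, k)) (e (ℓ', k))
  have hΩτ : ∀ k, Ω (τ k) = Ω k := fun k => Matrix.ext fun ℓ ℓ' => hGramτ ℓ ℓ' k
  have hΩif : ∀ k, k < τ k → Ω k = Ω₀ k := fun k h => Matrix.ext fun ℓ ℓ' => by
    simp only [Ω, Ω₀, Matrix.of_apply, he_if _ k h]
  have hdet : ∀ k, (Ω k).det ≠ 0 := by
    intro k
    rcases hlt_or k with h | h
    · rw [hΩif k h]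
      exact hdet₀ k
    · have h'' : τ k < τ (τ k) := by
        rw [hττ]
        exact h
      have hk : Ω k = Ω (τ k) := by rw [← hΩτ (τ k), hττ]
      rw [hk, hΩif (τ k) h'']
      exact hdet₀ _
  have hG : (Matrix.of fun i j : Fin N₁ × Fin m => B (e i) (e j)) = Matrix.blockDiagonal Ω := by
    ext ⟨ℓ, k⟩ ⟨ℓ', k'⟩
    rw [Matrix.of_apply, Matrix.blockDiagonal_apply']
    split_ifs with hkk'
    · subst hkk'
      rfl
    · exact hcr' ℓ ℓ' k k' hkk'
  have hGdet : (Matrix.of fun i j : Fin N₁ × Fin m => B (e i) (e j)).det ≠ 0 := by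
    rw [hG, Matrix.det_blockDiagonal]
    exact Finset.prod_ne_zero_iff.2 fun k _ => hdet k
  have hli : LinearIndependent ℂ e := linearIndependent_of_det_gram_ne_zero B e hGdet
  have hcard : Fintype.card (Fin N₁ × Fin m) = Module.finrank ℂ V := (Module.finrank_eq_card_basis b₀).symm
  let b : Module.Basis (Fin N₁ × Fin m) ℂ V := basisOfLinearIndependentOfCardEqFinrank hli hcard
  have hb : ∀ i, b i = e i := fun i => by
    change (basisOfLinearIndependentOfCardEqFinrank hli hcard) i = e i
    rw [coe_basisOfLinearIndependentOfCardEqFinrank]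
  refine ⟨m, μ, τ, b, c, hμ, hττ, hτne, fun ℓ k => ?_, fun ℓ ℓ' k k' hkk' => ?_, hc0, fun ℓ k => ?_,
    fun ℓ ℓ' k => ?_⟩
  · rw [hb]
    exact hJe ℓ k
  · rw [hb, hb]
    exact hcr' ℓ ℓ' k k' hkk'
  · rw [hb, hb]
    exact hKe ℓ k
  · rw [hb, hb, hb, hb]
    exact hGramτ ℓ ℓ' k

end LinkedBlocks

/-! ### §2 Prop. 3.6 (a) with multiplicity for the powers of an abelian variety with quaternionic
multiplication: `S(A)(ℂ) = ∏_{{σ,σ'}} Sp(V_σ)` acting diagonally on the linked pairs -/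

section Main

variable {A : AbelianVariety ℂ}

/-- Two linked pairs of blocks `{k, τ k}`, `{k', τ k'}` with the same smaller element coincide. [folklore] -/
private theorem eq_or_eq_of_min_eq {m : ℕ} {τ : Fin m → Fin m} (hττ : ∀ k, τ (τ k) = k) {k k' : Fin m}
    (h : min k (τ k) = min k' (τ k')) : k' = k ∨ k' = τ k := by
  rcases min_choice k (τ k) with hk | hk <;> rcases min_choice k' (τ k') with hk' | hk' <;> rw [hk, hk'] at h
  · exact Or.inl h.symm
  · right; rw [← hττ k', ← h]
  · exact Or.inr h.symm
  · left
    have e := congrArg τ h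
    rwa [hττ, hττ, eq_comm] at e

/-- **Milne 1999, Prop. 3.6 (a) with multiplicity and several blocks, `S(ℂ)`-form, for the powers of a
complex abelian variety with quaternionic multiplication** ("simple abelian variety of type II", §2 p. 649:
"`V_σ = V_{σ₁} ⊕ V_{σ₂}` […] `U(φ_{1,σ}) ∩ Sp(φ_{2,σ})` [is identified] with `Sp(φ_{2,σ₁})` […] standard
representation [on both halves]"). Let `ψ, κ ∈ End(A)` with `C(A) ⊗ ℂ` the commutant of `{ψ^*, κ^*}`, `ψ^*`
diagonalizable and self-adjoint for a polarization `h` with all eigenspaces `V_σ` of the same dimension,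
`κ^*` symmetric or antisymmetric (`Q_h(κ^*x, y) = ε Q_h(x, κ^*y)`, `ε = ±1`), `κ^* V_σ ⊆ V_{π(σ)}` with
`π(σ) ≠ σ`, and `κ^*κ^*` a non-zero scalar on each `V_σ`. Then for every `N` every class of
`H^{2p}(A^{N+1}(ℂ); ℂ)` fixed by `⋀^{2p}u` for all `u ∈ S(A^{N+1})(ℂ) =
unitaryCentralizerGroup (A.powSucc N) (Σᵢ prᵢ^* h)` lies in `Dᵖ(A^{N+1}) ⊗ ℂ` ("`(⋀^*(⊕ rH_σ))^{∏S_σ} =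
⊗_σ (⋀^* rH_σ)^{S_σ}` […] each […] generated by tensors of degree 2", here `r = 2(N + 1)`). Proof: the
several-blocks criterion `mem_divisorClassesSpan_of_forall_exteriorPullback_eq_of_spBlocks` on the letters
`prⱼ^* b(ℓ, k)` of the adapted basis of §1 (colour of the slot `(j, k)` = the linked pair `{k, τ k}`,
`Ω_k = Ω_{τ k}` the Gram matrix of `λQ_h` on `V_k`), the elements of `S(A)(ℂ)` acting by `g ∈ Sp(Ω_k)` on
`V_k ⊕ V_{τ k}` and their diagonal images in `S(A^{N+1})(ℂ)`, and `θ_k = ∑ (Ω_k⁻¹)_{ac} b(a,k) ⌣ b(c,k) ∈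
B¹(A) ⊗ ℂ` by Prop. 3.3 (`S(ℂ)`-form: every `u ∈ S(A)(ℂ)` preserves `V_k` and `Q_h|V_k`), the crossed
classes towards `V_{τ k}` being `(pr_{j'} ≫ κ)^*`-crossed classes of `θ_k`.
[cite: Milne1999LefschetzClasses, §1 p. 643, §2 pp. 649–650, Props. 3.3–3.4, 3.6 (a), p. 656, Cor. 4.5 (p. 659)]
[cite: GoodmanWallachGTM255, Thm. 5.3.3 (2), Thm. 5.3.5] -/
theorem mem_divisorClassesSpan_powSucc_of_forall_exteriorPullback_eq_of_quaternion
    (ψ κ : A ⟶ A) (hC : centralizerAlgebra A = Subalgebra.centralizer ℂ {pullbackOne A ψ, pullbackOne A κ})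
    (hdiag : ⨆ μ : ℂ, Module.End.eigenspace (pullbackOne A ψ) μ = ⊤) (N₁ : ℕ)
    (hn : ∀ μ : ℂ, Module.End.HasEigenvalue (pullbackOne A ψ) μ →
      Module.finrank ℂ (Module.End.eigenspace (pullbackOne A ψ) μ) = N₁)
    {h : complexBetti A.X 2} (hQ : IsRationalClass h)
    (hK : ∃ s : ℝ, 0 < s ∧ IsKaehlerClass A.dim A.X ((s : ℂ) • h))
    (hJQ : ∀ x y : complexBetti A.X 1,
      polarizationPairingOne A.X h (A.dim - 1) (pullbackOne A ψ x) y =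
        polarizationPairingOne A.X h (A.dim - 1) x (pullbackOne A ψ y))
    {ε : ℂ} (hε : ε = 1 ∨ ε = -1)
    (hκQ : ∀ x y : complexBetti A.X 1,
      polarizationPairingOne A.X h (A.dim - 1) (pullbackOne A κ x) y =
        ε • polarizationPairingOne A.X h (A.dim - 1) x (pullbackOne A κ y))
    (π : ℂ → ℂ) (hπ : ∀ μ : ℂ, Module.End.HasEigenvalue (pullbackOne A ψ) μ → π μ ≠ μ)
    (hlink : ∀ (μ : ℂ) (v : complexBetti A.X 1), v ∈ Module.End.eigenspace (pullbackOne A ψ) μ →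
      pullbackOne A κ v ∈ Module.End.eigenspace (pullbackOne A ψ) (π μ))
    (hκ2 : ∀ μ : ℂ, ∃ c : ℂ, c ≠ 0 ∧ ∀ v ∈ Module.End.eigenspace (pullbackOne A ψ) μ,
      pullbackOne A κ (pullbackOne A κ v) = c • v)
    (N p : ℕ) (x : complexBetti (A.powSucc N).X (2 * p))
    (hx : ∀ u ∈ unitaryCentralizerGroup (A.powSucc N) (powPolarizationClass A h N),
      exteriorPullback (AbelianVariety.hasExteriorCohomologyH1_complexPoints (A.powSucc N))
        (u : complexBetti (A.powSucc N).X 1 →ₗ[ℂ] complexBetti (A.powSucc N).X 1) (2 * p) x = x) :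
    x ∈ divisorClassesSpan (A.powSucc N).X (A.powSucc N).dim p := by
  classical
  haveI : Module.Finite ℂ (complexBetti A.X 1) := abelianVarietyCohomologyExteriorH1_holds.finite_one A
  haveI : Module.Finite ℂ (complexBetti (A.powSucc N).X 1) :=
    abelianVarietyCohomologyExteriorH1_holds.finite_one (A.powSucc N)
  have hX := AbelianVariety.hasExteriorCohomologyH1_complexPoints (A.powSucc N)
  have hXA := AbelianVariety.hasExteriorCohomologyH1_complexPoints A
  -- degree `0`: everything is a multiple of the unit class
  rcases Nat.eq_zero_or_pos p with rfl | hp1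
  · have htop : Submodule.span ℂ (Set.range (cupPowOne ℂ (ComplexPoints (A.powSucc N).X) 0)) = ⊤ :=
      hX.span_range_cupPowOne 0
    have hrange : Set.range (cupPowOne ℂ (ComplexPoints (A.powSucc N).X) 0) =
        {singularCohomology.one ℂ (ComplexPoints (A.powSucc N).X)} := by
      ext c
      simp only [Set.mem_range, cupPowOne_zero, Set.mem_singleton_iff]
      exact ⟨fun ⟨_, e⟩ => e.symm, fun e => ⟨fun i => Fin.elim0 i, e.symm⟩⟩
    have hx' : x ∈ Submodule.span ℂ (Set.range (cupPowOne ℂ (ComplexPoints (A.powSucc N).X) 0)) := by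
      rw [htop]; exact Submodule.mem_top
    rw [hrange] at hx'
    refine Submodule.span_mono (fun c hc => ?_) hx'
    rw [Set.mem_singleton_iff] at hc
    exact mem_divisorMonomials_zero.2 hc
  -- dimension `0`: no classes in positive degree
  rcases Nat.eq_zero_or_pos A.dim with hA | hA0
  · haveI : Subsingleton (complexBetti (A.powSucc N).X (2 * p)) :=
      hX.subsingleton_of_lt (by rw [AbelianVariety.finrank_complexBetti_one, dim_powSucc_eq_succ_mul, hA]; omega)
    rw [Subsingleton.elim x 0]
    exact Submodule.zero_mem _
  -- the polarization data of `A`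
  obtain ⟨s, hs, hKs⟩ := hK
  have hnd := eq_zero_of_forall_polarizationPairingOne_eq_zero_of_isKaehlerClass_smul' hs.ne' hKs
  have hh : h ∈ hodgeClassSpan A.dim A.X 1 := mem_hodgeClassSpan_one_of_isKaehlerClass_smul hQ hs.ne' hKs
  obtain ⟨Bf, hBalt, hBnd, lam, hlam, hBapp⟩ := exists_bilinForm_isAlt_nondegenerate (A := A) hnd
  set J : Module.End ℂ (complexBetti A.X 1) := pullbackOne A ψ with hJ_def
  set Kκ : Module.End ℂ (complexBetti A.X 1) := pullbackOne A κ with hK_def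
  have hJB : ∀ x y, Bf (J x) y = Bf x (J y) := fun x y => by rw [hBapp, hBapp, hJ_def, hJQ]
  have hKB : ∀ x y, Bf (Kκ x) y = ε * Bf x (Kκ y) := fun x y => by
    rw [hBapp, hBapp, hK_def, hκQ, map_smul, smul_eq_mul]
  have hV : 0 < Module.finrank ℂ (complexBetti A.X 1) := by
    rw [AbelianVariety.finrank_complexBetti_one]; omega
  -- the adapted eigenbasis with linked blocks of size `N₁`, and the block Gram matrices
  obtain ⟨m, μ, τ, b₁, c, hμ, hττ, hτne, hJb, hcr, hc0, hKb, hGramτ⟩ :=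
    exists_linkedBlockBasis Bf hBnd J Kκ hdiag hJB hV hn hε hKB π hπ hlink hκ2
  let Ωk : Fin m → Matrix (Fin N₁) (Fin N₁) ℂ := fun k => Matrix.of fun ℓ ℓ' => Bf (b₁ (ℓ, k)) (b₁ (ℓ', k))
  have hΩk : ∀ k ℓ ℓ', Ωk k ℓ ℓ' = Bf (b₁ (ℓ, k)) (b₁ (ℓ', k)) := fun _ _ _ => rfl
  have hGram : LinearMap.BilinForm.toMatrix b₁ Bf = Matrix.blockDiagonal Ωk := by
    ext ⟨ℓ, k⟩ ⟨ℓ', k'⟩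
    rw [LinearMap.BilinForm.toMatrix_apply, Matrix.blockDiagonal_apply']
    split_ifs with hkk'
    · subst hkk'
      rfl
    · exact hcr ℓ ℓ' k k' hkk'
  have hdetk : ∀ k, (Ωk k).det ≠ 0 := by
    have hdet : (LinearMap.BilinForm.toMatrix b₁ Bf).det ≠ 0 :=
      (LinearMap.BilinForm.nondegenerate_iff_det_ne_zero b₁).1 hBnd
    rw [hGram, Matrix.det_blockDiagonal] at hdet
    exact fun k => (Finset.prod_ne_zero_iff.1 hdet) k (Finset.mem_univ k)
  have hΩa : ∀ k, (Matrix.toBilin' (Ωk k)).IsAlt := fun k =>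
    isAlt_toBilin'_of_forall_eq_neg fun a c' => by rw [hΩk, hΩk, ← hBalt.neg_eq]
  have hΩn : ∀ k, (Matrix.toBilin' (Ωk k)).Nondegenerate := fun k =>
    LinearMap.BilinForm.nondegenerate_toBilin'_iff_det_ne_zero.2 (hdetk k)
  have hΩτ : ∀ k, Ωk (τ k) = Ωk k := fun k => Matrix.ext fun ℓ ℓ' => by rw [hΩk, hΩk, hGramτ]
  have hΩmin : ∀ k, Ωk (min k (τ k)) = Ωk k := fun k => by
    rcases min_choice k (τ k) with e | e <;> rw [e]
    exact hΩτ k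
  -- membership in `S(A)(ℂ)`: commute with `J` and `Kκ` (hence with `End(A)`, by `hC`) and preserve `Bf`
  have hmem : ∀ u : complexBetti A.X 1 ≃ₗ[ℂ] complexBetti A.X 1,
      J * (u : Module.End ℂ (complexBetti A.X 1)) = (u : Module.End ℂ (complexBetti A.X 1)) * J →
      Kκ * (u : Module.End ℂ (complexBetti A.X 1)) = (u : Module.End ℂ (complexBetti A.X 1)) * Kκ →
      (∀ a c', Bf (u a) (u c') = Bf a c') → u ∈ unitaryCentralizerGroup A h := by
    intro u hcommJ hcommK hu
    refine ⟨mem_centralizerGroup_iff_coe_mem.2 ?_, fun a c' => hlam (by rw [← hBapp, ← hBapp, hu a c'])⟩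
    rw [hC, Subalgebra.mem_centralizer_iff]
    intro g hg
    rcases hg with rfl | hg
    · exact hcommJ
    · rw [Set.mem_singleton_iff] at hg
      rw [hg]
      exact hcommK
  -- conversely an element of `S(A)(ℂ)` commutes with `J` and preserves `Bf`
  have hofmem : ∀ u ∈ unitaryCentralizerGroup A h,
      (∀ v, J (u v) = u (J v)) ∧ ∀ a c', Bf (u a) (u c') = Bf a c' := by
    intro u hu
    refine ⟨fun v => ?_, fun a c' => by rw [hBapp, hBapp, hu.2]⟩
    have hc' := mem_centralizerGroup_iff_coe_mem.1 hu.1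
    rw [hC, Subalgebra.mem_centralizer_iff] at hc'
    have e := hc' J (Set.mem_insert J _)
    exact LinearMap.congr_fun e v
  -- `θ_k = ∑ (Ω_k⁻¹)_{ac} b(a,k) ⌣ b(c,k) ∈ B¹(A) ⊗ ℂ`: fixed by every `u ∈ S(A)(ℂ)` (Prop. 3.3, `S(ℂ)`-form)
  have hΘ : ∀ k a c', (Ωk k)⁻¹ c' a = -(Ωk k)⁻¹ a c' := by
    intro k a c'
    have hΩunit : IsUnit (Ωk k).det := isUnit_iff_ne_zero.2 (hdetk k)
    have hΩt : (Ωk k)ᵀ = -Ωk k := Matrix.ext fun a c' => by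
      rw [Matrix.transpose_apply, Matrix.neg_apply]
      exact apply_eq_neg_of_isAlt (hΩa k) a c'
    have hΩit : (Ωk k)⁻¹ᵀ = -(Ωk k)⁻¹ := by
      rw [Matrix.transpose_nonsing_inv, hΩt]
      exact Matrix.inv_eq_left_inv (by rw [neg_mul_neg, Matrix.nonsing_inv_mul _ hΩunit])
    have e := congr_fun (congr_fun hΩit a) c'
    rwa [Matrix.transpose_apply, Matrix.neg_apply] at e
  have hθ : ∀ k, (∑ a, ∑ c', (Ωk k)⁻¹ a c' • cupProduct (rfl : 1 + 1 = 2) (b₁ (a, k)) (b₁ (c', k))) ∈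
      Submodule.span ℂ {c : complexBetti A.X 2 | IsRationalClass c ∧ IsOfHodgeType A.dim A.X 2 1 1 c} := by
    intro k
    have hΩunit : IsUnit (Ωk k).det := isUnit_iff_ne_zero.2 (hdetk k)
    refine mem_hodgeClassSpan_of_forall_exteriorPullback_eq hh (p := 1) fun u hu => ?_
    obtain ⟨huJ, huB⟩ := hofmem u hu
    set Mk : Matrix (Fin N₁) (Fin N₁) ℂ := Matrix.of fun ℓ' ℓ => b₁.repr (u (b₁ (ℓ, k))) (ℓ', k) with hMk
    have huM : ∀ ℓ, (u : complexBetti A.X 1 →ₗ[ℂ] complexBetti A.X 1) (b₁ (ℓ, k)) =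
        ∑ ℓ', Mk ℓ' ℓ • b₁ (ℓ', k) := fun ℓ => by
      rw [LinearEquiv.coe_coe]
      exact apply_basis_eq_sum_block b₁ J hμ hJb (u := ⇑u) huJ (fun c v => map_smul u c v) ℓ k
    have hMΩ : Mkᵀ * Ωk k * Mk = Ωk k := by
      ext ℓ ℓ'
      have e := bilin_apply_family_eq_transpose_mul_mul Bf (fun a => b₁ (a, k))
        (u := ⇑(u : complexBetti A.X 1 →ₗ[ℂ] complexBetti A.X 1)) (M := Mk) huM ℓ ℓ'
      rw [LinearEquiv.coe_coe, huB] at e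
      rw [← e]
      rfl
    have hinv : Mk * (Ωk k)⁻¹ * Mkᵀ = (Ωk k)⁻¹ := mul_inv_mul_transpose_eq hΩunit hMΩ
    change exteriorPullback hXA (u : complexBetti A.X 1 →ₗ[ℂ] complexBetti A.X 1) 2
      (∑ a, ∑ c', (Ωk k)⁻¹ a c' • cupProduct (rfl : 1 + 1 = 2) (b₁ (a, k)) (b₁ (c', k))) = _
    rw [map_sum]
    simp_rw [map_sum, map_smul, exteriorPullback_cupProduct_one_one]
    have key := sum_sum_smul_bilin_eq (cupProduct (rfl : 1 + 1 = 2)) (fun a => b₁ (a, k))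
      (u := ⇑(u : complexBetti A.X 1 →ₗ[ℂ] complexBetti A.X 1)) huM (Ωk k)⁻¹
    rw [key, hinv]
  -- the letters of `H¹(A^{N+1})`: `prⱼ^* b(ℓ, k)`, slots `(j, k)`, colour `min k (τ k)`
  let y : (Fin (N + 1) × Fin m) × Fin N₁ → complexBetti (A.powSucc N).X 1 := fun sl =>
    complexBetti.map (powSlots A N sl.1.1).hom.hom.hom 1 (b₁ (sl.2, sl.1.2))
  have hy : ∀ j k ℓ, y ((j, k), ℓ) = complexBetti.map (powSlots A N j).hom.hom.hom 1 (b₁ (ℓ, k)) :=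
    fun _ _ _ => rfl
  have hyspan : ⊤ ≤ Submodule.span ℂ (Set.range y) := by
    intro z _
    have hz := mem_span_map_powSlots A N z
    refine (Submodule.span_le.2 ?_) hz
    rintro _ ⟨⟨j, v⟩, rfl⟩
    change complexBetti.map (powSlots A N j).hom.hom.hom 1 v ∈ Submodule.span ℂ (Set.range y)
    rw [← b₁.sum_repr v, map_sum]
    refine Submodule.sum_mem _ fun a _ => ?_
    rw [map_smul]
    obtain ⟨ℓ, k⟩ := a
    exact Submodule.smul_mem _ _ (Submodule.subset_span ⟨((j, k), ℓ), rfl⟩)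
  have h2dim : 2 * A.dim = N₁ * m := by
    rw [← AbelianVariety.finrank_complexBetti_one, Module.finrank_eq_card_basis b₁, Fintype.card_prod,
      Fintype.card_fin, Fintype.card_fin]
  have hcard : Fintype.card ((Fin (N + 1) × Fin m) × Fin N₁) =
      Module.finrank ℂ (complexBetti (A.powSucc N).X 1) := by
    rw [AbelianVariety.finrank_complexBetti_one, dim_powSucc_eq_succ_mul,
      show 2 * ((N + 1) * A.dim) = (N + 1) * (2 * A.dim) by ring, h2dim]
    simp only [Fintype.card_prod, Fintype.card_fin]
    ring
  obtain ⟨bB, hbB⟩ : ∃ bB : Module.Basis ((Fin (N + 1) × Fin m) × Fin N₁) ℂ (complexBetti (A.powSucc N).X 1),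
      ∀ sl, bB sl = y sl :=
    ⟨basisOfTopLeSpanOfCardEqFinrank y hyspan hcard, fun sl => by rw [coe_basisOfTopLeSpanOfCardEqFinrank]⟩
  let col : Fin (N + 1) × Fin m → Fin m := fun t => min t.2 (τ t.2)
  -- THE CRITERION: the symplectic groups of the linked pairs acting diagonally on the slots
  refine mem_divisorClassesSpan_of_forall_exteriorPullback_eq_of_spBlocks bB col Ωk hΩa hΩn
    (unitaryCentralizerGroup (A.powSucc N) (powPolarizationClass A h N))
    (fun k₀ g hg => ?_) (fun t t' htt' => ?_) p x hx
  · -- the element acting by `g` on the blocks `k` with `{k, τ k} ∋ k₀ = min`, and its diagonal image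
    have hgdet : IsUnit g.det := by
      have hdet := congrArg Matrix.det hg
      rw [Matrix.det_mul, Matrix.det_mul, Matrix.det_transpose] at hdet
      have hsq : g.det * g.det = 1 := by
        have h1 : g.det * g.det * (Ωk k₀).det = 1 * (Ωk k₀).det := by
          rw [one_mul]
          calc g.det * g.det * (Ωk k₀).det = g.det * (Ωk k₀).det * g.det := by ring
            _ = (Ωk k₀).det := hdet
        exact mul_right_cancel₀ (hdetk k₀) h1
      exact IsUnit.of_mul_eq_one _ hsq
    let d : Fin m → Matrix (Fin N₁) (Fin N₁) ℂ := fun k => if min k (τ k) = k₀ then g else 1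
    have hdτ : ∀ k, d (τ k) = d k := fun k => by
      simp only [d, hττ, min_comm (τ k) k]
    have hd : ∀ k, (d k)ᵀ * Ωk k * d k = Ωk k := fun k => by
      by_cases hk : min k (τ k) = k₀
      · simp only [d, if_pos hk]
        rw [← hΩmin k, hk]
        exact hg
      · simp only [d, if_neg hk, Matrix.transpose_one, Matrix.one_mul, Matrix.mul_one]
    have hddet : ∀ k, (d k).det ≠ 0 := fun k => by
      by_cases hk : min k (τ k) = k₀
      · simp only [d, if_pos hk]
        exact hgdet.ne_zero
      · simp only [d, if_neg hk, Matrix.det_one]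
        exact one_ne_zero
    let M : Matrix (Fin N₁ × Fin m) (Fin N₁ × Fin m) ℂ := Matrix.blockDiagonal d
    have hMdet : IsUnit M.det := by
      refine isUnit_iff_ne_zero.2 ?_
      change (Matrix.blockDiagonal d).det ≠ 0
      rw [Matrix.det_blockDiagonal]
      exact Finset.prod_ne_zero_iff.2 fun k _ => hddet k
    let f : complexBetti A.X 1 →ₗ[ℂ] complexBetti A.X 1 := Matrix.toLin b₁ b₁ M
    have hfdet : IsUnit (LinearMap.toMatrix b₁ b₁ f).det := by
      change IsUnit (LinearMap.toMatrix b₁ b₁ (Matrix.toLin b₁ b₁ M)).det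
      rw [LinearMap.toMatrix_toLin]
      exact hMdet
    let u₁ : complexBetti A.X 1 ≃ₗ[ℂ] complexBetti A.X 1 := LinearEquiv.ofIsUnitDet hfdet
    have hu₁ : ∀ ℓ k, u₁ (b₁ (ℓ, k)) = ∑ ℓ', d k ℓ' ℓ • b₁ (ℓ', k) := fun ℓ k => by
      change f (b₁ (ℓ, k)) = _
      change Matrix.toLin b₁ b₁ M (b₁ (ℓ, k)) = _
      rw [Matrix.toLin_self, Fintype.sum_prod_type]
      refine Finset.sum_congr rfl fun ℓ' _ => ?_
      rw [Finset.sum_eq_single k]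
      · change Matrix.blockDiagonal d (ℓ', k) (ℓ, k) • b₁ (ℓ', k) = _
        rw [Matrix.blockDiagonal_apply_eq]
      · intro k' _ hk'
        change Matrix.blockDiagonal d (ℓ', k') (ℓ, k) • b₁ (ℓ', k') = 0
        rw [Matrix.blockDiagonal_apply_ne d ℓ' ℓ hk', zero_smul]
      · intro hk
        exact absurd (Finset.mem_univ k) hk
    have hu₁B : ∀ a c', Bf (u₁ a) (u₁ c') = Bf a c' := by
      have H : Bf.comp (u₁ : complexBetti A.X 1 →ₗ[ℂ] complexBetti A.X 1)
          (u₁ : complexBetti A.X 1 →ₗ[ℂ] complexBetti A.X 1) = Bf := by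
        refine LinearMap.BilinForm.ext_basis b₁ fun i j => ?_
        obtain ⟨ℓ, k⟩ := i
        obtain ⟨ℓ', k'⟩ := j
        rw [LinearMap.BilinForm.comp_apply, LinearEquiv.coe_coe]
        by_cases hkk' : k = k'
        · subst hkk'
          rw [bilin_apply_family_eq_transpose_mul_mul Bf (fun a => b₁ (a, k)) (u := ⇑u₁) (M := d k)
            (fun i => hu₁ i k) ℓ ℓ']
          change ((d k)ᵀ * Ωk k * d k) ℓ ℓ' = _
          rw [hd k, hΩk]
        · rw [hu₁, hu₁, bilin_sum_smul_sum_smul', hcr ℓ ℓ' k k' hkk']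
          refine Finset.sum_eq_zero fun a _ => Finset.sum_eq_zero fun c' _ => ?_
          rw [hcr a c' k k' hkk', mul_zero]
      intro a c'
      have e := congrArg (fun B' : LinearMap.BilinForm ℂ (complexBetti A.X 1) => B' a c') H
      simp only [LinearMap.BilinForm.comp_apply, LinearEquiv.coe_coe] at e
      exact e
    have hu₁J : J * (u₁ : Module.End ℂ (complexBetti A.X 1)) = (u₁ : Module.End ℂ (complexBetti A.X 1)) * J := by
      refine b₁.ext fun i => ?_
      obtain ⟨ℓ, k⟩ := i
      rw [Module.End.mul_apply, Module.End.mul_apply, LinearEquiv.coe_coe, hJb, map_smul, hu₁, map_sum,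
        Finset.smul_sum]
      refine Finset.sum_congr rfl fun ℓ' _ => ?_
      rw [map_smul, hJb, smul_comm]
    have hu₁K : Kκ * (u₁ : Module.End ℂ (complexBetti A.X 1)) =
        (u₁ : Module.End ℂ (complexBetti A.X 1)) * Kκ := by
      refine b₁.ext fun i => ?_
      obtain ⟨ℓ, k⟩ := i
      rw [Module.End.mul_apply, Module.End.mul_apply, LinearEquiv.coe_coe, hKb, map_smul, hu₁, map_sum,
        hu₁, Finset.smul_sum, hdτ]
      refine Finset.sum_congr rfl fun ℓ' _ => ?_
      rw [map_smul, hKb, smul_comm]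
    have hu₁S : u₁ ∈ unitaryCentralizerGroup A h := hmem u₁ hu₁J hu₁K hu₁B
    refine ⟨diagPow A u₁ N, diagPow_mem_unitaryCentralizerGroup hA0 hu₁S N, fun t ℓ => ?_⟩
    obtain ⟨j, k⟩ := t
    rw [hbB, hy, diagPow_intertwine_right hu₁S.1, hu₁, map_sum]
    refine Finset.sum_congr rfl fun ℓ' _ => ?_
    rw [map_smul, hbB, hy]
  · -- the crossed classes of two slots of one colour are divisor classes
    obtain ⟨j, k⟩ := t
    obtain ⟨j', k'⟩ := t'
    change min k (τ k) = min k' (τ k') at htt'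
    simp_rw [hbB]
    change (∑ a, ∑ c', (Ωk (min k (τ k)))⁻¹ a c' • cupProduct (rfl : 1 + 1 = 2)
      (complexBetti.map (powSlots A N j).hom.hom.hom 1 (b₁ (a, k)))
      (complexBetti.map (powSlots A N j').hom.hom.hom 1 (b₁ (c', k')))) ∈ _
    rw [hΩmin k]
    rcases eq_or_eq_of_min_eq hττ htt' with hk' | hk' <;> subst k'
    · -- the same block on two slots
      exact sum_smul_cross_mem_span_rational_oneOne (powSlots A N j) (powSlots A N j') (fun a => b₁ (a, k))
        (Ωk k)⁻¹ (hΘ k) (hθ k)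
    · -- the linked block: its letters are `κ^*`-translates, the maps are `prⱼ` and `pr_{j'} ≫ κ`
      have hb' : ∀ c', b₁ (c', τ k) = (c k)⁻¹ • Kκ (b₁ (c', k)) := fun c' => by
        rw [hKb, smul_smul, inv_mul_cancel₀ (hc0 k), one_smul]
      have hrw : ∀ a c', cupProduct (rfl : 1 + 1 = 2)
          (complexBetti.map (powSlots A N j).hom.hom.hom 1 (b₁ (a, k)))
          (complexBetti.map (powSlots A N j').hom.hom.hom 1 (b₁ (c', τ k))) =
          (c k)⁻¹ • cupProduct (rfl : 1 + 1 = 2)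
            (complexBetti.map (powSlots A N j).hom.hom.hom 1 (b₁ (a, k)))
            (complexBetti.map (powSlots A N j' ≫ κ).hom.hom.hom 1 (b₁ (c', k))) := by
        intro a c'
        rw [hb', map_smul, map_smul, complexBetti_map_comp_apply]
      simp_rw [hrw, smul_comm _ (c k)⁻¹, ← Finset.smul_sum]
      exact Submodule.smul_mem _ _ (sum_smul_cross_mem_span_rational_oneOne (powSlots A N j)
        (powSlots A N j' ≫ κ) (fun a => b₁ (a, k)) (Ωk k)⁻¹ (hΘ k) (hθ k))

/-- **The polarization package of every power `A^{N+1}` of an abelian variety with quaternionic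
multiplication** (`0 < dim A`): Milne's class `Σᵢ prᵢ^* h ∈ B¹(A^{N+1}) ⊗ ℂ` with `(Σᵢ prᵢ^* h)^{dim} ≠ 0`,
`Q` non-degenerate (`SpecialLefschetzGroupOneEqUnitaryCentralizer` §Powers) and the `S(ℂ)`-form above — the
datum consumed by `SpecialLefschetzGroupInvariantsFiniteProducts` (packages of factors ⇒ packages of finite
`Hom`-orthogonal products). [cite: Milne1999LefschetzClasses, §1 p. 643, Prop. 3.4, Cor. 4.5 (p. 659)] -/
theorem exists_polarization_invariants_le_powSucc_of_quaternion (ψ κ : A ⟶ A)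
    (hC : centralizerAlgebra A = Subalgebra.centralizer ℂ {pullbackOne A ψ, pullbackOne A κ})
    (hdiag : ⨆ μ : ℂ, Module.End.eigenspace (pullbackOne A ψ) μ = ⊤) (N₁ : ℕ)
    (hn : ∀ μ : ℂ, Module.End.HasEigenvalue (pullbackOne A ψ) μ →
      Module.finrank ℂ (Module.End.eigenspace (pullbackOne A ψ) μ) = N₁)
    {h : complexBetti A.X 2} (hQ : IsRationalClass h)
    (hK : ∃ s : ℝ, 0 < s ∧ IsKaehlerClass A.dim A.X ((s : ℂ) • h))
    (hJQ : ∀ x y : complexBetti A.X 1,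
      polarizationPairingOne A.X h (A.dim - 1) (pullbackOne A ψ x) y =
        polarizationPairingOne A.X h (A.dim - 1) x (pullbackOne A ψ y))
    {ε : ℂ} (hε : ε = 1 ∨ ε = -1)
    (hκQ : ∀ x y : complexBetti A.X 1,
      polarizationPairingOne A.X h (A.dim - 1) (pullbackOne A κ x) y =
        ε • polarizationPairingOne A.X h (A.dim - 1) x (pullbackOne A κ y))
    (π : ℂ → ℂ) (hπ : ∀ μ : ℂ, Module.End.HasEigenvalue (pullbackOne A ψ) μ → π μ ≠ μ)
    (hlink : ∀ (μ : ℂ) (v : complexBetti A.X 1), v ∈ Module.End.eigenspace (pullbackOne A ψ) μ →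
      pullbackOne A κ v ∈ Module.End.eigenspace (pullbackOne A ψ) (π μ))
    (hκ2 : ∀ μ : ℂ, ∃ c : ℂ, c ≠ 0 ∧ ∀ v ∈ Module.End.eigenspace (pullbackOne A ψ) μ,
      pullbackOne A κ (pullbackOne A κ v) = c • v)
    (hA0 : 0 < A.dim) (N : ℕ) :
    ∃ D : complexBetti (A.powSucc N).X 2, D ∈ hodgeClassSpan (A.powSucc N).dim (A.powSucc N).X 1 ∧
      lefschetzPow D ((A.powSucc N).dim - 1) 2 D ≠ 0 ∧
      (∀ z : complexBetti (A.powSucc N).X 1,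
        (∀ y, polarizationPairingOne (A.powSucc N).X D ((A.powSucc N).dim - 1) z y = 0) → z = 0) ∧
      ∀ (a : ℕ) (y : complexBetti (A.powSucc N).X (2 * a)), (∀ u ∈ unitaryCentralizerGroup (A.powSucc N) D,
        exteriorPullback (AbelianVariety.hasExteriorCohomologyH1_complexPoints (A.powSucc N))
          (u : complexBetti (A.powSucc N).X 1 →ₗ[ℂ] complexBetti (A.powSucc N).X 1) (2 * a) y = y) →
        y ∈ divisorClassesSpan (A.powSucc N).X (A.powSucc N).dim a := by
  obtain ⟨s, hs, hKs⟩ := hK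
  have hnd := eq_zero_of_forall_polarizationPairingOne_eq_zero_of_isKaehlerClass_smul' hs.ne' hKs
  have hh : h ∈ hodgeClassSpan A.dim A.X 1 := mem_hodgeClassSpan_one_of_isKaehlerClass_smul hQ hs.ne' hKs
  have htop : lefschetzPow h (A.dim - 1) 2 h ≠ 0 := lefschetzPow_self_ne_zero_of_isKaehlerClass_smul hA0 hKs
  exact ⟨powPolarizationClass A h N, powPolarizationClass_mem_hodgeClassSpan hh N,
    lefschetzPow_powPolarizationClass_self_ne_zero hA0 htop N,
    eq_zero_of_forall_polarizationPairingOne_powPolarizationClass_eq_zero hA0 htop hnd N,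
    fun a y hy => mem_divisorClassesSpan_powSucc_of_forall_exteriorPullback_eq_of_quaternion ψ κ hC hdiag N₁
      hn hQ ⟨s, hs, hKs⟩ hJQ hε hκQ π hπ hlink hκ2 N a y hy⟩

/-- **The conclusion of the record `Milne1999_specialLefschetzGroup_invariants_le` (Milne 1999, Cor. 4.5 with
Thm. 4.4, Thm. 3.2 and Prop. 3.6 (a) WITH MULTIPLICITY, §2 type II) PROVED for every power of an abelian
variety with quaternionic multiplication**: for `A` as above and every `N`, every class
`x ∈ H^{2p}(A^{N+1}(ℂ); ℂ)` fixed by every element of `specialLefschetzGroup (dim A^{N+1}) (A^{N+1}).X` lies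
in `Dᵖ_hom(A^{N+1})_ℂ` (`A^{N+1} = A.powSucc N`; in dimension `0` there is nothing to prove).
[cite: Milne1999LefschetzClasses, §2 p. 649, Cor. 4.5 and Cor. 4.7 (p. 659), Thm. 3.2, Prop. 3.6 (a), p. 656]
[cite: GoodmanWallachGTM255, Thm. 5.3.3] -/
theorem specialLefschetzGroup_invariants_le_powSucc_of_quaternion (ψ κ : A ⟶ A)
    (hC : centralizerAlgebra A = Subalgebra.centralizer ℂ {pullbackOne A ψ, pullbackOne A κ})
    (hdiag : ⨆ μ : ℂ, Module.End.eigenspace (pullbackOne A ψ) μ = ⊤) (N₁ : ℕ)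
    (hn : ∀ μ : ℂ, Module.End.HasEigenvalue (pullbackOne A ψ) μ →
      Module.finrank ℂ (Module.End.eigenspace (pullbackOne A ψ) μ) = N₁)
    {h : complexBetti A.X 2} (hQ : IsRationalClass h)
    (hK : ∃ s : ℝ, 0 < s ∧ IsKaehlerClass A.dim A.X ((s : ℂ) • h))
    (hJQ : ∀ x y : complexBetti A.X 1,
      polarizationPairingOne A.X h (A.dim - 1) (pullbackOne A ψ x) y =
        polarizationPairingOne A.X h (A.dim - 1) x (pullbackOne A ψ y))
    {ε : ℂ} (hε : ε = 1 ∨ ε = -1)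
    (hκQ : ∀ x y : complexBetti A.X 1,
      polarizationPairingOne A.X h (A.dim - 1) (pullbackOne A κ x) y =
        ε • polarizationPairingOne A.X h (A.dim - 1) x (pullbackOne A κ y))
    (π : ℂ → ℂ) (hπ : ∀ μ : ℂ, Module.End.HasEigenvalue (pullbackOne A ψ) μ → π μ ≠ μ)
    (hlink : ∀ (μ : ℂ) (v : complexBetti A.X 1), v ∈ Module.End.eigenspace (pullbackOne A ψ) μ →
      pullbackOne A κ v ∈ Module.End.eigenspace (pullbackOne A ψ) (π μ))
    (hκ2 : ∀ μ : ℂ, ∃ c : ℂ, c ≠ 0 ∧ ∀ v ∈ Module.End.eigenspace (pullbackOne A ψ) μ,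
      pullbackOne A κ (pullbackOne A κ v) = c • v)
    (N p : ℕ) (x : complexBetti (A.powSucc N).X (2 * p))
    (hx : ∀ g ∈ specialLefschetzGroup (A.powSucc N).dim (A.powSucc N).X, g (2 * p) x = x) :
    x ∈ divisorClassesSpan (A.powSucc N).X (A.powSucc N).dim p := by
  classical
  have hX := AbelianVariety.hasExteriorCohomologyH1_complexPoints (A.powSucc N)
  rcases Nat.eq_zero_or_pos A.dim with hA | hA0
  · -- dimension `0`: `H^{2p}(A^{N+1}) = 0` for `p ≥ 1`, `H⁰ = ℂ · 1`
    rcases Nat.eq_zero_or_pos p with rfl | hp1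
    · have htop : Submodule.span ℂ (Set.range (cupPowOne ℂ (ComplexPoints (A.powSucc N).X) 0)) = ⊤ :=
        hX.span_range_cupPowOne 0
      have hrange : Set.range (cupPowOne ℂ (ComplexPoints (A.powSucc N).X) 0) =
          {singularCohomology.one ℂ (ComplexPoints (A.powSucc N).X)} := by
        ext c
        simp only [Set.mem_range, cupPowOne_zero, Set.mem_singleton_iff]
        exact ⟨fun ⟨_, e⟩ => e.symm, fun e => ⟨fun i => Fin.elim0 i, e.symm⟩⟩
      have hx' : x ∈ Submodule.span ℂ (Set.range (cupPowOne ℂ (ComplexPoints (A.powSucc N).X) 0)) := by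
        rw [htop]; exact Submodule.mem_top
      rw [hrange] at hx'
      refine Submodule.span_mono (fun c hc => ?_) hx'
      rw [Set.mem_singleton_iff] at hc
      exact mem_divisorMonomials_zero.2 hc
    · haveI : Module.Finite ℂ (complexBetti (A.powSucc N).X 1) :=
        abelianVarietyCohomologyExteriorH1_holds.finite_one (A.powSucc N)
      haveI : Subsingleton (complexBetti (A.powSucc N).X (2 * p)) :=
        hX.subsingleton_of_lt (by rw [AbelianVariety.finrank_complexBetti_one, dim_powSucc_eq_succ_mul, hA]; omega)
      rw [Subsingleton.elim x 0]
      exact Submodule.zero_mem _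
  · exact specialLefschetzGroup_invariants_le_of_exists_polarization_invariants_le (dim_powSucc_pos hA0 N)
      (exists_polarization_invariants_le_powSucc_of_quaternion ψ κ hC hdiag N₁ hn hQ hK hJQ hε hκQ π hπ hlink hκ2 hA0 N) p x hx

/-- **The record for every complex abelian variety ISOGENOUS to a power of an abelian variety with
quaternionic multiplication** ("`S(A)` depends only on the isogeny class of `A`", §1 p. 644; Cor. 4.7).
[cite: Milne1999LefschetzClasses, §1 p. 644, Prop. 1.5, Cor. 4.5 and Cor. 4.7 (p. 659)] -/
theorem specialLefschetzGroup_invariants_le_of_isIsogenous_powSucc_of_quaternion {X : AbelianVariety ℂ}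
    (ψ κ : A ⟶ A)
    (hC : centralizerAlgebra A = Subalgebra.centralizer ℂ {pullbackOne A ψ, pullbackOne A κ})
    (hdiag : ⨆ μ : ℂ, Module.End.eigenspace (pullbackOne A ψ) μ = ⊤) (N₁ : ℕ)
    (hn : ∀ μ : ℂ, Module.End.HasEigenvalue (pullbackOne A ψ) μ →
      Module.finrank ℂ (Module.End.eigenspace (pullbackOne A ψ) μ) = N₁)
    {h : complexBetti A.X 2} (hQ : IsRationalClass h)
    (hK : ∃ s : ℝ, 0 < s ∧ IsKaehlerClass A.dim A.X ((s : ℂ) • h))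
    (hJQ : ∀ x y : complexBetti A.X 1,
      polarizationPairingOne A.X h (A.dim - 1) (pullbackOne A ψ x) y =
        polarizationPairingOne A.X h (A.dim - 1) x (pullbackOne A ψ y))
    {ε : ℂ} (hε : ε = 1 ∨ ε = -1)
    (hκQ : ∀ x y : complexBetti A.X 1,
      polarizationPairingOne A.X h (A.dim - 1) (pullbackOne A κ x) y =
        ε • polarizationPairingOne A.X h (A.dim - 1) x (pullbackOne A κ y))
    (π : ℂ → ℂ) (hπ : ∀ μ : ℂ, Module.End.HasEigenvalue (pullbackOne A ψ) μ → π μ ≠ μ)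
    (hlink : ∀ (μ : ℂ) (v : complexBetti A.X 1), v ∈ Module.End.eigenspace (pullbackOne A ψ) μ →
      pullbackOne A κ v ∈ Module.End.eigenspace (pullbackOne A ψ) (π μ))
    (hκ2 : ∀ μ : ℂ, ∃ c : ℂ, c ≠ 0 ∧ ∀ v ∈ Module.End.eigenspace (pullbackOne A ψ) μ,
      pullbackOne A κ (pullbackOne A κ v) = c • v)
    (hA0 : 0 < A.dim) {N : ℕ} (hXA : AbelianVariety.IsIsogenous X (A.powSucc N)) (p : ℕ)
    (x : complexBetti X.X (2 * p)) (hx : ∀ g ∈ specialLefschetzGroup X.dim X.X, g (2 * p) x = x) :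
    x ∈ divisorClassesSpan X.X X.dim p :=
  specialLefschetzGroup_invariants_le_of_isIsogenous_of_exists hXA (dim_powSucc_pos hA0 N)
    (exists_polarization_invariants_le_powSucc_of_quaternion ψ κ hC hdiag N₁ hn hQ hK hJQ hε hκQ π hπ hlink hκ2 hA0 N) p x hx

/-- **Cor. 4.5 as an equality of sets on the powers of an abelian variety with quaternionic multiplication**:
the `S(A^{N+1})`-invariants of `H^{2p}(A^{N+1}(ℂ); ℂ)` are EXACTLY `Dᵖ_hom(A^{N+1})_ℂ` (the converse
inclusion is definitional, `apply_eq_self_of_mem_specialLefschetzGroup`).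
[cite: Milne1999LefschetzClasses, Cor. 4.5 (p. 659)] -/
theorem setOf_forall_apply_eq_self_eq_divisorClassesSpan_powSucc_of_quaternion (ψ κ : A ⟶ A)
    (hC : centralizerAlgebra A = Subalgebra.centralizer ℂ {pullbackOne A ψ, pullbackOne A κ})
    (hdiag : ⨆ μ : ℂ, Module.End.eigenspace (pullbackOne A ψ) μ = ⊤) (N₁ : ℕ)
    (hn : ∀ μ : ℂ, Module.End.HasEigenvalue (pullbackOne A ψ) μ →
      Module.finrank ℂ (Module.End.eigenspace (pullbackOne A ψ) μ) = N₁)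
    {h : complexBetti A.X 2} (hQ : IsRationalClass h)
    (hK : ∃ s : ℝ, 0 < s ∧ IsKaehlerClass A.dim A.X ((s : ℂ) • h))
    (hJQ : ∀ x y : complexBetti A.X 1,
      polarizationPairingOne A.X h (A.dim - 1) (pullbackOne A ψ x) y =
        polarizationPairingOne A.X h (A.dim - 1) x (pullbackOne A ψ y))
    {ε : ℂ} (hε : ε = 1 ∨ ε = -1)
    (hκQ : ∀ x y : complexBetti A.X 1,
      polarizationPairingOne A.X h (A.dim - 1) (pullbackOne A κ x) y =
        ε • polarizationPairingOne A.X h (A.dim - 1) x (pullbackOne A κ y))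
    (π : ℂ → ℂ) (hπ : ∀ μ : ℂ, Module.End.HasEigenvalue (pullbackOne A ψ) μ → π μ ≠ μ)
    (hlink : ∀ (μ : ℂ) (v : complexBetti A.X 1), v ∈ Module.End.eigenspace (pullbackOne A ψ) μ →
      pullbackOne A κ v ∈ Module.End.eigenspace (pullbackOne A ψ) (π μ))
    (hκ2 : ∀ μ : ℂ, ∃ c : ℂ, c ≠ 0 ∧ ∀ v ∈ Module.End.eigenspace (pullbackOne A ψ) μ,
      pullbackOne A κ (pullbackOne A κ v) = c • v)
    (N p : ℕ) :
    {x : complexBetti (A.powSucc N).X (2 * p) |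
        ∀ g ∈ specialLefschetzGroup (A.powSucc N).dim (A.powSucc N).X, g (2 * p) x = x} =
      (divisorClassesSpan (A.powSucc N).X (A.powSucc N).dim p : Set _) :=
  Set.Subset.antisymm
    (fun x hx => specialLefschetzGroup_invariants_le_powSucc_of_quaternion ψ κ hC hdiag N₁ hn hQ hK hJQ hε hκQ π hπ hlink hκ2 N p x hx)
    fun _ hx _ hg => apply_eq_self_of_mem_specialLefschetzGroup hg hx

/-- **Milne Prop. 4.8, (c) ⇒ (a) on every power of an abelian variety with quaternionic multiplication,
record-free**: if `Hg′(A^{N+1}) = S(A^{N+1})` then `A^{N+1}` supports no exotic Hodge class (van Geemen's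
`B(A^{N+1}) = D(A^{N+1})`). [cite: Milne1999LefschetzClasses, Prop. 4.8 and Cor. 4.5 (pp. 659–660)] -/
theorem isDivisorGenerated_powSucc_of_hodgeGroup_eq_specialLefschetzGroup_of_quaternion (ψ κ : A ⟶ A)
    (hC : centralizerAlgebra A = Subalgebra.centralizer ℂ {pullbackOne A ψ, pullbackOne A κ})
    (hdiag : ⨆ μ : ℂ, Module.End.eigenspace (pullbackOne A ψ) μ = ⊤) (N₁ : ℕ)
    (hn : ∀ μ : ℂ, Module.End.HasEigenvalue (pullbackOne A ψ) μ →
      Module.finrank ℂ (Module.End.eigenspace (pullbackOne A ψ) μ) = N₁)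
    {h : complexBetti A.X 2} (hQ : IsRationalClass h)
    (hK : ∃ s : ℝ, 0 < s ∧ IsKaehlerClass A.dim A.X ((s : ℂ) • h))
    (hJQ : ∀ x y : complexBetti A.X 1,
      polarizationPairingOne A.X h (A.dim - 1) (pullbackOne A ψ x) y =
        polarizationPairingOne A.X h (A.dim - 1) x (pullbackOne A ψ y))
    {ε : ℂ} (hε : ε = 1 ∨ ε = -1)
    (hκQ : ∀ x y : complexBetti A.X 1,
      polarizationPairingOne A.X h (A.dim - 1) (pullbackOne A κ x) y =
        ε • polarizationPairingOne A.X h (A.dim - 1) x (pullbackOne A κ y))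
    (π : ℂ → ℂ) (hπ : ∀ μ : ℂ, Module.End.HasEigenvalue (pullbackOne A ψ) μ → π μ ≠ μ)
    (hlink : ∀ (μ : ℂ) (v : complexBetti A.X 1), v ∈ Module.End.eigenspace (pullbackOne A ψ) μ →
      pullbackOne A κ v ∈ Module.End.eigenspace (pullbackOne A ψ) (π μ))
    (hκ2 : ∀ μ : ℂ, ∃ c : ℂ, c ≠ 0 ∧ ∀ v ∈ Module.End.eigenspace (pullbackOne A ψ) μ,
      pullbackOne A κ (pullbackOne A κ v) = c • v)
    (N : ℕ)
    (hHg : hodgeGroup (A.powSucc N).dim (A.powSucc N).X =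
      specialLefschetzGroup (A.powSucc N).dim (A.powSucc N).X) :
    IsDivisorGenerated (A.powSucc N) :=
  fun p c hc hpp => specialLefschetzGroup_invariants_le_powSucc_of_quaternion ψ κ hC hdiag N₁ hn hQ hK hJQ hε hκQ π hπ hlink hκ2 N p c
    fun _ hg => apply_eq_self_of_mem_hodgeGroup (hHg ▸ hg) hc hpp

end Main

end Literature.AlgebraicGeometry.Milne1999
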